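import Summits.CriticalPhenomena.PercolationContinuityZ3.Theorems.PercNearOneGluingNoHeavyLowerTailKnQuestion8CoefficientwiseCoreClassKernelMixShortThreadPrep
import HarnessLib

/-!
# The pendant-edge slice identity and IET on hairy graphs for edge-blind events

Support file (`--supports stmt-CriticalPhenomena-4575`, closed), prover `prim-cplus-coupling` (gen 54).  No definitions, no notations, no named facts,
no sorries; standard axioms.  Memo `prim-cplus-coupling/A5-COUPLING-gen54.md` §2.3.

`G⁺ = G + g`, `g = x–b` a PENDANT EDGE at the observer `b` (`x` a fresh vertex).  Since `C_u(η + g) = C_u(η) ∪ {x : b ∈ C_u(η)}`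
(`Coefficientwise.cluster_insert_hubEdge_b`, gen 53), slicing the IET sum of `G⁺` by the colour of `g` gives the EXACT identity
`Coefficientwise.iet_split_pendantEdge_b`:
  IET(G⁺)(𝒱; h,k; hᵃ,hᵇ; kᵃ,kᵇ) = S_G(𝒱(·+g); h∘ins x, k∘ins x; hᵃ, hᵇ; kᵃ, kᵇ) + S_G(𝒱; h, k; hᵃ, hᵇ∘ins x; kᵃ, kᵇ∘ins x),
the first slice a legitimate IET instance on `G`, the second NOT (`hᵇ∘ins x ≰ h`): the smallest 'invalid word' (memo §1.3: the R-cylinder of a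
new thread of length 3 is exactly this situation).  With the MIXING inequality (memo §2.2, `…KernelMixMixing`) the two slices on a COMMON event
dominate two legitimate mixed instances, whence `Coefficientwise.iet_pendantEdge_b_of_blind`: if IET holds on `G` for the event `𝒱` and all
admissible levels, then IET holds on `G + pendant edge at b` for every `g`-blind event (`𝒱(ω + g) ↔ 𝒱(ω)`) and all admissible levels — the
equal-event half of the pendant-edge step; the nested half (`𝒱(·+g) ⊋ 𝒱`) is open (memo §2.4).
[cite: KozmaNitzan2024, Questions 8–9 (§5.5 p. 36) (context); Harris 1960]
-/

namespace Summit.CriticalPhenomena.PercolationContinuityZ3.Theorems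

open Finset Literature.Probability.Percolation

namespace Coefficientwise

variable {ι V : Type*}

open Classical in
/-- **Pendant edge at the observer: the slice identity.**  `E′` an edge set of a multigraph `ends`, `g ∉ E′` with `ends g = s(x,b)`, `x ≠ u, b`
on no edge of `E′`.  The IET sum of `(ends, E′+g)` for the event `𝒱` and levels `h,k,hᵃ,hᵇ,kᵃ,kᵇ` equals the `g`-red slice (event `𝒱(·+g)`, target
levels `h,k ∘ insert x`, demand levels unchanged) plus the `g`-blue slice (event `𝒱`, targets `h,k`, demand levels `hᵇ,kᵇ ∘ insert x`). -/
theorem iet_split_pendantEdge_b (ends : ι → Sym2 V) (E' : Finset ι) (g : ι) (u b x : V)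
    (hgE' : g ∉ E') (hg : ends g = s(x, b)) (hxu : x ≠ u) (hxb : x ≠ b) (hxE' : ∀ i ∈ E', x ∉ ends i)
    (𝒱 : Finset ι → Prop) (h k ha hb ka kb : Set V → ℝ) :
    ((∑ ω ∈ (insert g E').powerset, if 𝒱 ω ∧ b ∈ openCluster (ends '' (↑ω : Set ι)) u ∧
          b ∉ openCluster (ends '' (↑((insert g E') \ ω) : Set ι)) u then
        h (openCluster (ends '' (↑ω : Set ι)) u) * k (openCluster (ends '' (↑ω : Set ι)) u) else 0)
      + ∑ ω ∈ (insert g E').powerset, if 𝒱 ω ∧ b ∈ openCluster (ends '' (↑((insert g E') \ ω) : Set ι)) u ∧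
          b ∉ openCluster (ends '' (↑ω : Set ι)) u then
        (ha (openCluster (ends '' (↑ω : Set ι)) u) - hb (openCluster (ends '' (↑((insert g E') \ ω) : Set ι)) u)) *
          (ka (openCluster (ends '' (↑ω : Set ι)) u) - kb (openCluster (ends '' (↑((insert g E') \ ω) : Set ι)) u)) else 0)
    = ((∑ η ∈ E'.powerset, if 𝒱 (insert g η) ∧ b ∈ openCluster (ends '' (↑η : Set ι)) u ∧ b ∉ openCluster (ends '' (↑(E' \ η) : Set ι)) u then
          h (insert x (openCluster (ends '' (↑η : Set ι)) u)) * k (insert x (openCluster (ends '' (↑η : Set ι)) u)) else 0)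
        + ∑ η ∈ E'.powerset, if 𝒱 (insert g η) ∧ b ∈ openCluster (ends '' (↑(E' \ η) : Set ι)) u ∧ b ∉ openCluster (ends '' (↑η : Set ι)) u then
          (ha (openCluster (ends '' (↑η : Set ι)) u) - hb (openCluster (ends '' (↑(E' \ η) : Set ι)) u)) *
            (ka (openCluster (ends '' (↑η : Set ι)) u) - kb (openCluster (ends '' (↑(E' \ η) : Set ι)) u)) else 0)
      + ((∑ η ∈ E'.powerset, if 𝒱 η ∧ b ∈ openCluster (ends '' (↑η : Set ι)) u ∧ b ∉ openCluster (ends '' (↑(E' \ η) : Set ι)) u then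
          h (openCluster (ends '' (↑η : Set ι)) u) * k (openCluster (ends '' (↑η : Set ι)) u) else 0)
        + ∑ η ∈ E'.powerset, if 𝒱 η ∧ b ∈ openCluster (ends '' (↑(E' \ η) : Set ι)) u ∧ b ∉ openCluster (ends '' (↑η : Set ι)) u then
          (ha (openCluster (ends '' (↑η : Set ι)) u) - hb (insert x (openCluster (ends '' (↑(E' \ η) : Set ι)) u))) *
            (ka (openCluster (ends '' (↑η : Set ι)) u) - kb (insert x (openCluster (ends '' (↑(E' \ η) : Set ι)) u))) else 0) := by
  set E : Finset ι := insert g E' with hE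
  set C : Finset ι → Set V := fun ω => openCluster (ends '' (↑ω : Set ι)) u with hC
  have hbx : b ≠ x := fun h => hxb h.symm
  -- complements
  have sdiff_g : ∀ η, η ⊆ E' → E \ insert g η = E' \ η := by
    intro η hη
    ext i
    simp only [hE, Finset.mem_sdiff, Finset.mem_insert]
    constructor
    · rintro ⟨h1, h2⟩
      push Not at h2
      rcases h1 with rfl | h1
      · exact absurd rfl h2.1
      · exact ⟨h1, h2.2⟩
    · rintro ⟨h1, h2⟩
      refine ⟨Or.inr h1, ?_⟩
      push Not; exact ⟨fun h' => hgE' (h' ▸ h1), h2⟩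
  have sdiff_0 : ∀ η, η ⊆ E' → E \ η = insert g (E' \ η) := by
    intro η hη
    ext i
    simp only [hE, Finset.mem_sdiff, Finset.mem_insert]
    constructor
    · rintro ⟨h1, h2⟩
      rcases h1 with rfl | h1
      · exact Or.inl rfl
      · exact Or.inr ⟨h1, h2⟩
    · rintro (rfl | ⟨h1, h2⟩)
      · exact ⟨Or.inl rfl, fun h' => hgE' (hη h')⟩
      · exact ⟨Or.inr h1, h2⟩
  -- cluster identities
  have hxE'sub : ∀ η, η ⊆ E' → ∀ i ∈ η, x ∉ ends i := fun η hη i hi => hxE' i (hη hi)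
  have hxE'sd : ∀ η : Finset ι, ∀ i ∈ E' \ η, x ∉ ends i := fun η i hi => hxE' i (Finset.sdiff_subset hi)
  have Cg : ∀ η, η ⊆ E' → C (insert g η) = C η ∪ {y | y = x ∧ b ∈ C η} := fun η hη =>
    cluster_insert_hubEdge_b ends η g u b x hg hxu hxb (hxE'sub η hη)
  have Cg' : ∀ η : Finset ι, C (insert g (E' \ η)) = C (E' \ η) ∪ {y | y = x ∧ b ∈ C (E' \ η)} := fun η =>
    cluster_insert_hubEdge_b ends (E' \ η) g u b x hg hxu hxb (hxE'sd η)
  have mem_union_x : ∀ (S : Set V) (P : Prop), b ∈ S ∪ {y | y = x ∧ P} ↔ b ∈ S := fun S P => mem_union_single_iff hbx S P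
  have union_x_of : ∀ (S : Set V) (P : Prop), P → S ∪ {y | y = x ∧ P} = insert x S := fun S P hP => union_single_of_pos x S P hP
  have union_x_of_not : ∀ (S : Set V) (P : Prop), ¬ P → S ∪ {y | y = x ∧ P} = S := fun S P hP => union_single_of_neg x S P hP
  -- summands
  set FR : Finset ι → ℝ := fun ω => if 𝒱 ω ∧ b ∈ C ω ∧ b ∉ C (E \ ω) then h (C ω) * k (C ω) else 0 with hFR
  set FD : Finset ι → ℝ := fun ω => if 𝒱 ω ∧ b ∈ C (E \ ω) ∧ b ∉ C ω then
      (ha (C ω) - hb (C (E \ ω))) * (ka (C ω) - kb (C (E \ ω))) else 0 with hFD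
  change (∑ ω ∈ E.powerset, FR ω) + ∑ ω ∈ E.powerset, FD ω = _
  have split : ∀ F : Finset ι → ℝ, ∑ ω ∈ E.powerset, F ω = (∑ η ∈ E'.powerset, F η) + ∑ η ∈ E'.powerset, F (insert g η) :=
    fun F => Finset.sum_powerset_insert hgE' F
  rw [split FR, split FD]
  -- slice g red
  have eRg : ∀ η ∈ E'.powerset, FR (insert g η) = (if 𝒱 (insert g η) ∧ b ∈ C η ∧ b ∉ C (E' \ η) then
      h (insert x (C η)) * k (insert x (C η)) else 0) := by
    intro η hη
    rw [Finset.mem_powerset] at hη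
    simp only [hFR]
    apply ite_zero_congr
    · rw [sdiff_g η hη, Cg η hη, mem_union_x]
    · intro hq
      rw [Cg η hη, union_x_of _ _ hq.2.1]
  have eDg : ∀ η ∈ E'.powerset, FD (insert g η) = (if 𝒱 (insert g η) ∧ b ∈ C (E' \ η) ∧ b ∉ C η then
      (ha (C η) - hb (C (E' \ η))) * (ka (C η) - kb (C (E' \ η))) else 0) := by
    intro η hη
    rw [Finset.mem_powerset] at hη
    simp only [hFD]
    apply ite_zero_congr
    · rw [sdiff_g η hη, Cg η hη, mem_union_x]
    · intro hq
      rw [Cg η hη, union_x_of_not _ _ hq.2.2, sdiff_g η hη]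
  -- slice g blue
  have eR0 : ∀ η ∈ E'.powerset, FR η = (if 𝒱 η ∧ b ∈ C η ∧ b ∉ C (E' \ η) then h (C η) * k (C η) else 0) := by
    intro η hη
    rw [Finset.mem_powerset] at hη
    simp only [hFR]
    apply ite_zero_congr
    · rw [sdiff_0 η hη, Cg' η, mem_union_x]
    · intro _; rfl
  have eD0 : ∀ η ∈ E'.powerset, FD η = (if 𝒱 η ∧ b ∈ C (E' \ η) ∧ b ∉ C η then
      (ha (C η) - hb (insert x (C (E' \ η)))) * (ka (C η) - kb (insert x (C (E' \ η)))) else 0) := by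
    intro η hη
    rw [Finset.mem_powerset] at hη
    simp only [hFD]
    apply ite_zero_congr
    · rw [sdiff_0 η hη, Cg' η, mem_union_x]
    · intro hq
      rw [sdiff_0 η hη, Cg' η, union_x_of _ _ hq.2.1]
  rw [Finset.sum_congr rfl eRg, Finset.sum_congr rfl eDg, Finset.sum_congr rfl eR0, Finset.sum_congr rfl eD0]
  ring

open Classical in
/-- **IET on `G + pendant edge at b` for `g`-blind events.**  `E′, g, x` as in `iet_split_pendantEdge_b`.  Suppose the IET sum of `(ends, E′)` on the
event `𝒱` is nonnegative for ALL admissible level systems (monotone, `0 ≤ hᵃ,hᵇ ≤ h`, `0 ≤ kᵃ,kᵇ ≤ k`), and `𝒱` is `g`-blind (`𝒱(ω + g) ↔ 𝒱 ω`).  Then the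
IET sum of `(ends, E′ + g)` on `𝒱` is nonnegative for all admissible level systems.  Proof: the slice identity, then the mixing inequality (memo §2.2):
slices ≥ S(h, k∘ins x; hᵃ,hᵇ; kᵃ,kᵇ∘ins x) + S(h∘ins x, k; hᵃ,hᵇ∘ins x; kᵃ,kᵇ) pointwise, and both mixed systems are admissible on `(ends, E′)`. -/
theorem iet_pendantEdge_b_of_blind (ends : ι → Sym2 V) (E' : Finset ι) (g : ι) (u b x : V)
    (hgE' : g ∉ E') (hg : ends g = s(x, b)) (hxu : x ≠ u) (hxb : x ≠ b) (hxE' : ∀ i ∈ E', x ∉ ends i)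
    (𝒱 : Finset ι → Prop) (hblind : ∀ ω, 𝒱 (insert g ω) ↔ 𝒱 ω)
    (HG : ∀ (h k ha hb ka kb : Set V → ℝ), Monotone h → Monotone k → Monotone ha → Monotone hb → Monotone ka → Monotone kb →
      (∀ S, 0 ≤ ha S) → (∀ S, ha S ≤ h S) → (∀ S, 0 ≤ hb S) → (∀ S, hb S ≤ h S) →
      (∀ S, 0 ≤ ka S) → (∀ S, ka S ≤ k S) → (∀ S, 0 ≤ kb S) → (∀ S, kb S ≤ k S) →
      0 ≤ (∑ η ∈ E'.powerset, if 𝒱 η ∧ b ∈ openCluster (ends '' (↑η : Set ι)) u ∧ b ∉ openCluster (ends '' (↑(E' \ η) : Set ι)) u then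
            h (openCluster (ends '' (↑η : Set ι)) u) * k (openCluster (ends '' (↑η : Set ι)) u) else 0)
        + ∑ η ∈ E'.powerset, if 𝒱 η ∧ b ∈ openCluster (ends '' (↑(E' \ η) : Set ι)) u ∧ b ∉ openCluster (ends '' (↑η : Set ι)) u then
            (ha (openCluster (ends '' (↑η : Set ι)) u) - hb (openCluster (ends '' (↑(E' \ η) : Set ι)) u)) *
              (ka (openCluster (ends '' (↑η : Set ι)) u) - kb (openCluster (ends '' (↑(E' \ η) : Set ι)) u)) else 0)
    (h k ha hb ka kb : Set V → ℝ) (mh : Monotone h) (mk : Monotone k)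
    (mha : Monotone ha) (mhb : Monotone hb) (mka : Monotone ka) (mkb : Monotone kb)
    (ha0 : ∀ S, 0 ≤ ha S) (hah : ∀ S, ha S ≤ h S) (hb0 : ∀ S, 0 ≤ hb S) (hbh : ∀ S, hb S ≤ h S)
    (ka0 : ∀ S, 0 ≤ ka S) (kak : ∀ S, ka S ≤ k S) (kb0 : ∀ S, 0 ≤ kb S) (kbk : ∀ S, kb S ≤ k S) :
    0 ≤ (∑ ω ∈ (insert g E').powerset, if 𝒱 ω ∧ b ∈ openCluster (ends '' (↑ω : Set ι)) u ∧
          b ∉ openCluster (ends '' (↑((insert g E') \ ω) : Set ι)) u then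
        h (openCluster (ends '' (↑ω : Set ι)) u) * k (openCluster (ends '' (↑ω : Set ι)) u) else 0)
      + ∑ ω ∈ (insert g E').powerset, if 𝒱 ω ∧ b ∈ openCluster (ends '' (↑((insert g E') \ ω) : Set ι)) u ∧
          b ∉ openCluster (ends '' (↑ω : Set ι)) u then
        (ha (openCluster (ends '' (↑ω : Set ι)) u) - hb (openCluster (ends '' (↑((insert g E') \ ω) : Set ι)) u)) *
          (ka (openCluster (ends '' (↑ω : Set ι)) u) - kb (openCluster (ends '' (↑((insert g E') \ ω) : Set ι)) u)) else 0 := by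
  rw [iet_split_pendantEdge_b ends E' g u b x hgE' hg hxu hxb hxE' 𝒱 h k ha hb ka kb]
  simp only [hblind]
  set C : Finset ι → Set V := fun ω => openCluster (ends '' (↑ω : Set ι)) u with hC
  -- shifted levels
  have mins : Monotone (fun S : Set V => insert x S) := fun S T hST => Set.insert_subset_insert hST
  have mh' : Monotone (fun S => h (insert x S)) := mh.comp mins
  have mk' : Monotone (fun S => k (insert x S)) := mk.comp mins
  have mhb' : Monotone (fun S => hb (insert x S)) := mhb.comp mins
  have mkb' : Monotone (fun S => kb (insert x S)) := mkb.comp mins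
  have hsub : ∀ S : Set V, S ≤ insert x S := fun S => Set.subset_insert x S
  -- the two mixed (admissible) systems on (ends, E′)
  have mix1 := HG h (fun S => k (insert x S)) ha hb ka (fun S => kb (insert x S)) mh mk' mha mhb mka mkb'
    ha0 hah hb0 hbh ka0 (fun S => (kak S).trans (mk (hsub S))) (fun S => kb0 _) (fun S => kbk _)
  have mix2 := HG (fun S => h (insert x S)) k ha (fun S => hb (insert x S)) ka kb mh' mk mha mhb' mka mkb
    ha0 (fun S => (hah S).trans (mh (hsub S))) (fun S => hb0 _) (fun S => hbh _) ka0 kak kb0 kbk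
  -- pointwise domination (mixing)
  have hR : ∀ η ∈ E'.powerset,
      (if 𝒱 η ∧ b ∈ C η ∧ b ∉ C (E' \ η) then h (C η) * k (insert x (C η)) else 0)
        + (if 𝒱 η ∧ b ∈ C η ∧ b ∉ C (E' \ η) then h (insert x (C η)) * k (C η) else 0)
        ≤ (if 𝒱 η ∧ b ∈ C η ∧ b ∉ C (E' \ η) then h (insert x (C η)) * k (insert x (C η)) else 0)
          + (if 𝒱 η ∧ b ∈ C η ∧ b ∉ C (E' \ η) then h (C η) * k (C η) else 0) := by
    intro η _
    split_ifs
    · nlinarith [mul_nonneg (sub_nonneg.mpr (mh (hsub (C η)))) (sub_nonneg.mpr (mk (hsub (C η))))]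
    · simp
  have hD : ∀ η ∈ E'.powerset,
      (if 𝒱 η ∧ b ∈ C (E' \ η) ∧ b ∉ C η then (ha (C η) - hb (C (E' \ η))) * (ka (C η) - kb (insert x (C (E' \ η)))) else 0)
        + (if 𝒱 η ∧ b ∈ C (E' \ η) ∧ b ∉ C η then (ha (C η) - hb (insert x (C (E' \ η)))) * (ka (C η) - kb (C (E' \ η))) else 0)
        ≤ (if 𝒱 η ∧ b ∈ C (E' \ η) ∧ b ∉ C η then (ha (C η) - hb (C (E' \ η))) * (ka (C η) - kb (C (E' \ η))) else 0)
          + (if 𝒱 η ∧ b ∈ C (E' \ η) ∧ b ∉ C η then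
              (ha (C η) - hb (insert x (C (E' \ η)))) * (ka (C η) - kb (insert x (C (E' \ η)))) else 0) := by
    intro η _
    split_ifs
    · nlinarith [mul_nonneg (sub_nonneg.mpr (mhb (hsub (C (E' \ η))))) (sub_nonneg.mpr (mkb (hsub (C (E' \ η)))))]
    · simp
  have hRs := Finset.sum_le_sum hR
  have hDs := Finset.sum_le_sum hD
  rw [Finset.sum_add_distrib] at hRs hDs
  rw [Finset.sum_add_distrib] at hRs hDs
  simp only [hC] at hRs hDs mix1 mix2
  linarith

end Coefficientwise

end Summit.CriticalPhenomena.PercolationContinuityZ3.Theorems
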